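import Summits.NavierStokesRegularity.NavierStokesRegularity.Theorems.TerminalTraceTraceDensityCriterionTypeI
import Literature.Analysis.FluidPDE.SereginSverak2002FinalEnergyIff
import Literature.Analysis.FluidPDE.SereginSverakBlowupSelection
import HarnessLib

/-!
# Crux `TerminalTrace.TraceDensityCriterion` (stmt-NavierStokesRegularity-18614), Type-I-in-time cell — the IFF:
# for a Type-I-in-time first singularity the singular points of the final slice are exactly the density scars of `u(T)`

Seat nsreg-C26-p1 g6 (cell ns-regularity-ideate), `--supports stmt-NavierStokesRegularity-18614` (helper; closes nothing).
Seregin–Šverák 2002 characterise the regular points of the final slice by the vanishing of the scaled energy of the final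
value under a one-sided pressure bound (tree: `SereginSverak2002.isBackwardBoundedAt_top_iff_tendsto_scaledEnergy`); here
the one-sided pressure bound is replaced by the Type-I-in-time rate `IsTypeIBlowup u T`, using the landed Type-I cell
`TerminalTrace.typeI_traceDensityCriterion` (p652624) for «⇐» and the rate-free passage of a backward bound to the weak
`L²` trace (`SereginSverak2002.tendsto_scaledEnergy_final_of_isBackwardBoundedAt`) for «⇒»:

* `TerminalTrace.isBackwardBoundedAt_of_eLpNorm_lt_top` — bridge: an essentially bounded backward cylinder at `(T, x₀)`
  of a classical solution on `[0, T)` makes the vertex backward bounded (continuity below `T`);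
* `TerminalTrace.typeI_isBackwardBoundedAt_iff_tendsto_scaledEnergy` — under `IsTypeIBlowup u T`:
  `IsBackwardBoundedAt u T x₀ ↔ r⁻¹ ∫_{B(x₀,r)} ‖u T‖² → 0`;
* `TerminalTrace.typeI_singular_iff_not_tendsto_scaledEnergy` — the same in the route's singular-vertex vocabulary:
  `(∀ r > 0, ‖u‖_{L^∞(Q_r(T,x₀))} = ∞) ↔ ¬ (r⁻¹ ∫_{B(x₀,r)} ‖u T‖² → 0)`.

WHAT THIS IS NOT: not NS regularity, not the crux (no rate hypothesis there); a characterisation for HYPOTHETICAL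
Type-I-in-time blow-ups. [cite: SereginSverak2002, Thm. 2.2 (p. 70)] [folklore; EscauriazaSereginSverak2003 §3]
-/

noncomputable section

set_option linter.dupNamespace false

namespace Summit.NavierStokesRegularity.NavierStokesRegularity.Theorems

open MeasureTheory Set Function Filter Topology TopologicalSpace Metric
open Literature.Analysis.FluidPDE
open scoped NNReal ENNReal InnerProductSpace RealInnerProductSpace

/-- **An essentially bounded backward cylinder at `(T, x₀)` makes the vertex backward bounded** (the converse of the
singular-vertex bridge `IsBackwardBoundedAt.eLpNorm_parabolicCylinder_lt_top`, for a field continuous below `T`): for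
`(u, p)` classical on `[0, T) × ℝ³`, if `‖u‖_{L^∞(Q_r(T, x₀))} < ∞` for some `r > 0` then `‖u‖ ≤ K` pointwise on a smaller
backward cylinder `Q_{r'}(T, x₀)`, `r'² < T` (an a.e. bound of a continuous function on an open set holds everywhere,
`SereginSverak2009.forall_le_of_ae_le_of_continuousOn`). [folklore] -/
theorem TerminalTrace.isBackwardBoundedAt_of_eLpNorm_lt_top {ν T : ℝ} (hT : 0 < T)
    {u : ℝ → EuclideanSpace ℝ (Fin 3) → EuclideanSpace ℝ (Fin 3)} {p : ℝ → EuclideanSpace ℝ (Fin 3) → ℝ}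
    (hcl : IsClassicalNSSolutionOn (Ico 0 T) ν 0 u p) {x₀ : EuclideanSpace ℝ (Fin 3)} {r : ℝ} (hr : 0 < r)
    (hfin : eLpNorm (uncurry u) ⊤ (volume.restrict (parabolicCylinder r (T, x₀))) < ⊤) :
    IsBackwardBoundedAt u T x₀ := by
  -- a smaller radius with `r'² < T`, so that `Q_{r'}(T, x₀) ⊆ [0, T) × ℝ³`
  set r' : ℝ := min r (Real.sqrt T / 2) with hr'
  have hsq : 0 < Real.sqrt T := Real.sqrt_pos.2 hT
  have hr'0 : 0 < r' := lt_min hr (by positivity)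
  have hr'r : r' ≤ r := min_le_left _ _
  have hr'T : r' ^ 2 < T := by
    have h1 : r' ≤ Real.sqrt T / 2 := min_le_right _ _
    have h2 : r' ^ 2 ≤ (Real.sqrt T / 2) ^ 2 := pow_le_pow_left₀ hr'0.le h1 2
    rw [div_pow, Real.sq_sqrt hT.le] at h2
    linarith
  set Q' : Set (ℝ × EuclideanSpace ℝ (Fin 3)) := parabolicCylinder r' (T, x₀) with hQ'
  have hQ'Q : Q' ⊆ parabolicCylinder r (T, x₀) := by
    intro z hz
    rw [hQ', mem_parabolicCylinder] at hz
    rw [mem_parabolicCylinder]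
    have : r' ^ 2 ≤ r ^ 2 := pow_le_pow_left₀ hr'0.le hr'r 2
    exact ⟨⟨by linarith [hz.1.1], hz.1.2⟩, lt_of_lt_of_le hz.2 hr'r⟩
  have hQ'slab : Q' ⊆ Ico 0 T ×ˢ (univ : Set (EuclideanSpace ℝ (Fin 3))) := by
    intro z hz
    rw [hQ', mem_parabolicCylinder] at hz
    exact ⟨⟨by simp only at hz; linarith [hz.1.1], hz.1.2⟩, mem_univ _⟩
  -- the essential bound `K` on `Q_r`, a.e. on `Q'`
  set K : ℝ := (eLpNorm (uncurry u) ⊤ (volume.restrict (parabolicCylinder r (T, x₀)))).toReal with hK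
  have hae : ∀ᵐ z ∂(volume.restrict Q'), ‖uncurry u z‖ ≤ K := by
    have h1 : ∀ᵐ z ∂(volume.restrict (parabolicCylinder r (T, x₀))), ‖uncurry u z‖ ≤ K := by
      filter_upwards [ae_le_eLpNormEssSup (μ := volume.restrict (parabolicCylinder r (T, x₀)))
        (f := uncurry u)] with z hz
      rw [← eLpNorm_exponent_top] at hz
      have h2 := ENNReal.toReal_mono hfin.ne hz
      rwa [toReal_enorm] at h2
    exact ae_restrict_of_ae_restrict_of_subset hQ'Q h1
  -- continuity below `T` upgrades the a.e. bound to a pointwise one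
  have hcont : ContinuousOn (fun z => ‖uncurry u z‖) Q' :=
    ((SereginSverak2002.continuousOn_uncurry hcl).mono hQ'slab).norm
  have hall := SereginSverak2009.forall_le_of_ae_le_of_continuousOn (μ := volume)
    (isOpen_parabolicCylinder r' (T, x₀)) hcont continuousOn_const hae
  refine ⟨r', hr'0, K, fun t ht x hx => ?_⟩
  have hz : ((t, x) : ℝ × EuclideanSpace ℝ (Fin 3)) ∈ Q' := by
    rw [hQ', mem_parabolicCylinder]
    exact ⟨ht, mem_ball.1 hx⟩
  exact hall (t, x) hz

/-- **For a Type-I-in-time first singularity the singular points of the final slice are EXACTLY the density scars of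
the final value** (Seregin–Šverák's final-value characterisation, Thm. 2.2 / (4.8), with the one-sided pressure hypothesis
replaced by the Type-I rate): in the frame (`ν, T > 0`, classical on `[0, T)`, Leray–Hopf on `[0, T]`, rapidly decaying
datum), under `IsTypeIBlowup u T`, for every `x₀` — `(T, x₀)` is backward bounded IFF `r⁻¹ ∫_{B(x₀,r)} ‖u T‖² → 0`.
(⇒: a backward bound passes to the weak `L²` trace, `SereginSverak2002.tendsto_scaledEnergy_final_of_isBackwardBoundedAt`,
no rate needed; ⇐: the Type-I cell `TerminalTrace.typeI_traceDensityCriterion`.)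
[cite: SereginSverak2002, Thm. 2.2 (p. 70)] [folklore; EscauriazaSereginSverak2003 §3] -/
theorem TerminalTrace.typeI_isBackwardBoundedAt_iff_tendsto_scaledEnergy {ν T : ℝ} (hν : 0 < ν) (hT : 0 < T)
    {u : ℝ → EuclideanSpace ℝ (Fin 3) → EuclideanSpace ℝ (Fin 3)} {p : ℝ → EuclideanSpace ℝ (Fin 3) → ℝ}
    (hcl : IsClassicalNSSolutionOn (Ico 0 T) ν 0 u p) (hLH : IsLerayHopfOn T ν 0 (u 0) u)
    (hdec : HasRapidSpatialDecay (u 0)) (hI : IsTypeIBlowup u T) (x₀ : EuclideanSpace ℝ (Fin 3)) :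
    IsBackwardBoundedAt u T x₀ ↔
      Tendsto (fun r : ℝ => r⁻¹ * ∫ x in ball x₀ r, ‖u T x‖ ^ 2) (𝓝[>] 0) (𝓝 0) :=
  ⟨SereginSverak2002.tendsto_scaledEnergy_final_of_isBackwardBoundedAt hT hLH,
    TerminalTrace.typeI_traceDensityCriterion ν T hν hT u p hcl hLH hdec hI x₀⟩

/-- **The singular set of the final slice of a Type-I-in-time first singularity, read off the final value**: under
`IsTypeIBlowup u T`, the backward-singular vertices `(T, x₀)` of the route's vocabulary (`u` essentially unbounded on
every `Q_r(T, x₀)`) are exactly the points where the scaled energy of `u T` does NOT tend to zero.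
[folklore; EscauriazaSereginSverak2003 §3; SereginSverak2002 Thm. 2.2] -/
theorem TerminalTrace.typeI_singular_iff_not_tendsto_scaledEnergy {ν T : ℝ} (hν : 0 < ν) (hT : 0 < T)
    {u : ℝ → EuclideanSpace ℝ (Fin 3) → EuclideanSpace ℝ (Fin 3)} {p : ℝ → EuclideanSpace ℝ (Fin 3) → ℝ}
    (hcl : IsClassicalNSSolutionOn (Ico 0 T) ν 0 u p) (hLH : IsLerayHopfOn T ν 0 (u 0) u)
    (hdec : HasRapidSpatialDecay (u 0)) (hI : IsTypeIBlowup u T) (x₀ : EuclideanSpace ℝ (Fin 3)) :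
    (∀ r : ℝ, 0 < r → eLpNorm (uncurry u) ⊤ (volume.restrict (parabolicCylinder r (T, x₀))) = ⊤) ↔
      ¬ Tendsto (fun r : ℝ => r⁻¹ * ∫ x in ball x₀ r, ‖u T x‖ ^ 2) (𝓝[>] 0) (𝓝 0) := by
  rw [← TerminalTrace.typeI_isBackwardBoundedAt_iff_tendsto_scaledEnergy hν hT hcl hLH hdec hI x₀]
  refine ⟨fun hsing hbb => ?_, fun hnot r hr => ?_⟩
  · obtain ⟨r, hr, hfin⟩ := hbb.eLpNorm_parabolicCylinder_lt_top
    exact hfin.ne (hsing r hr)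
  · by_contra hne
    exact hnot (TerminalTrace.isBackwardBoundedAt_of_eLpNorm_lt_top hT hcl hr (lt_top_iff_ne_top.2 hne))

end Summit.NavierStokesRegularity.NavierStokesRegularity.Theorems

end
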